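import Mathlib
import Summits.MatrixMultiplication.MatrixMultiplication.Theses.FourierTwoFamiliesModP
import Summits.MatrixMultiplication.MatrixMultiplication.Theorems.FourierTwoFamiliesModPPrimeTwoFamiliesLadderConverse
import Summits.MatrixMultiplication.MatrixMultiplication.Theorems.FourierTwoFamiliesModPPrimeTwoFamiliesLadderEquivalence
import Literature.Computability.AlgebraicComplexity.SimultaneousDoubleProduct

/-!
# `PrimeTwoFamilies` ↔ PRIME symmetric cyclic ladders (crux stmt-MatrixMultiplication-14308, stub `cyclicLadder_of_primeTwoFamilies`)

Crux `FourierTwoFamiliesModP.PrimeTwoFamilies` (CKSU 2005 Conj. 4.7 with prime cyclic hosts) in its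
HOST-INDEXED LADDER NORMAL FORM, assembled from landed lemmas of line `Sketch`: the exponent bookkeeping
`LadderLift.ladder_exponents` (Theorems/…LadderConverse) and the ladder equivalence
`LadderLift.primeTwoFamilies_iff_cyclicLadder` (Theorems/…LadderEquivalence).

* `primeSymmLadder_of_primeTwoFamilies` — the normal form of an SDPP witness: for every `ε > 0` and `m₀`
  there is a PRIME `m ≥ m₀` and `r` pairs `(X c, Y c)` in `ZMod m` with (i) every class direct, (ii) the
  SYMMETRIC escape clause (classes `p ≠ q`, both directions — clause (X) of the crux at
  `(i, j, k) = (p, c, q)`), two-sided host control `m^{1/2-ε} ≤ r`, `m ≤ r^{2+ε}`, and co-volumes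
  `m^{1-ε} ≤ |X c| |Y c|`.  Compared with the registered (ordered, any-modulus) ladder form it remembers
  that the host is prime, that separation holds in both directions, and the upper host bound.
* `cyclicLadder_of_primeSymmLadder` — forgetting those three data gives the ordered ladder form.
* `cyclicLadder_of_primeTwoFamilies` — the registered stub of the crux item, verbatim: the composition.
* `primeTwoFamilies_iff_primeSymmLadder` — so the prime symmetric form is a fifth equivalent form of the
  crux (with ladders / capacity gadgets / self-converse gadgets / packing-tight families): a refuter of
  the ladder conjecture may assume the modulus PRIME, separation in BOTH directions and `m ≤ r^{2+ε}`.

Nothing here is new mathematics: an SDPP witness `(A i, B i)_{i<n}` of the slice `δ = min ε 1` in `ℤ/p`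
is read as a ladder with `m = p`, `r = n`; `p ≤ n^{2+δ}` and `n^{2-δ} ≤ |A i||B i| ≤ p` give the exponents.
-/

-- single-conjunct summit: the mandated namespace repeats `MatrixMultiplication` (summit = sub-problem).
set_option linter.dupNamespace false

namespace Summit.MatrixMultiplication.MatrixMultiplication.Theorems.PrimeTwoFamilies.LadderSiegeK7

open Finset
open Summit.MatrixMultiplication.MatrixMultiplication.Theses
open Summit.MatrixMultiplication.MatrixMultiplication.Theorems.PrimeTwoFamilies
open Literature.Computability.AlgebraicComplexity

/-- **Prime symmetric ladders from the crux.**  `PrimeTwoFamilies` yields, for every `ε > 0` and `m₀`,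
a prime `m ≥ m₀` and `r` classes `(X c, Y c)` in `ZMod m` such that (i) every class is direct
(`(x - x') + (y - y') = 0 → x = x' ∧ y = y'` on `X c × Y c`), (ii) for all classes `p ≠ q` every cross
difference `y' - x'` (`x' ∈ X p`, `y' ∈ Y q`) avoids every diagonal difference `y - x` (`x ∈ X c`,
`y ∈ Y c`), with `m^{1/2-ε} ≤ r`, `m ≤ r^{2+ε}` and `m^{1-ε} ≤ |X c| |Y c|` for every `c`.
Proof: take an SDPP witness of the slice `δ = min ε 1` beyond `m₀ + 2` pairs; it is such a family in
`ℤ/p` (clause (X) at `(i, j, k) = (p', c, q)` is (ii)); `m₀ ≤ p` because `m₀ + 2 ≤ n ≤ n^{2-δ} ≤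
|A i||B i| ≤ p` (a direct pair packs into `ZMod p`); the exponents are `LadderLift.ladder_exponents`. -/
theorem primeSymmLadder_of_primeTwoFamilies (hT : FourierTwoFamiliesModP.PrimeTwoFamilies) :
    ∀ ε : ℝ, 0 < ε → ∀ m₀ : ℕ, ∃ m ≥ m₀, m.Prime ∧ ∃ r : ℕ, ∃ X Y : Fin r → Finset (ZMod m),
      ((∀ c : Fin r, ∀ x ∈ X c, ∀ x' ∈ X c, ∀ y ∈ Y c, ∀ y' ∈ Y c,
          (x - x') + (y - y') = 0 → x = x' ∧ y = y') ∧
        (∀ c p q : Fin r, p ≠ q → ∀ x ∈ X c, ∀ y ∈ Y c, ∀ x' ∈ X p, ∀ y' ∈ Y q,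
          y - x ≠ y' - x')) ∧
      ((m : ℝ) ^ (1 / 2 - ε) ≤ (r : ℝ) ∧ (m : ℝ) ≤ (r : ℝ) ^ (2 + ε)) ∧
      ∀ c : Fin r, (m : ℝ) ^ (1 - ε) ≤ (((X c).card * (Y c).card : ℕ) : ℝ) := by
  intro ε hε m₀
  set δ : ℝ := min ε 1 with hδdef
  have hδ : 0 < δ := lt_min hε one_pos
  have hδε : δ ≤ ε := min_le_left _ _
  have hδ1 : δ ≤ 1 := min_le_right _ _
  obtain ⟨n, hn, p, hp, A, B, hW, hX, hpn, hAB⟩ := hT δ hδ (m₀ + 2)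
  haveI : Fact p.Prime := ⟨hp⟩
  have hn1 : 1 ≤ n := by omega
  have hn1' : (1 : ℝ) ≤ n := by exact_mod_cast hn1
  -- `m₀ ≤ p`: `m₀ + 2 ≤ n ≤ n^{2-δ} ≤ |A i||B i| ≤ p`
  have i₀ : Fin n := ⟨0, by omega⟩
  have hABp : (A i₀).card * (B i₀).card ≤ p := by
    have := card_mul_card_le_of_dpp (H := ZMod p) (hW i₀)
    rwa [ZMod.card] at this
  have hm₀ : m₀ ≤ p := by
    have h1 : (n : ℝ) ≤ (n : ℝ) ^ (2 - δ) := by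
      calc (n : ℝ) = (n : ℝ) ^ (1 : ℝ) := (Real.rpow_one _).symm
        _ ≤ (n : ℝ) ^ (2 - δ) := Real.rpow_le_rpow_of_exponent_le hn1' (by linarith)
    have h2 : (n : ℝ) ≤ (p : ℝ) := (h1.trans (hAB i₀)).trans (by exact_mod_cast hABp)
    have h3 : n ≤ p := by exact_mod_cast h2
    omega
  obtain ⟨hr, hcov⟩ := LadderLift.ladder_exponents hδ hδε hδ1 hp.one_lt.le hn1 hpn
  have hpn' : (p : ℝ) ≤ (n : ℝ) ^ (2 + ε) :=
    hpn.trans (Real.rpow_le_rpow_of_exponent_le hn1' (by linarith))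
  refine ⟨p, hm₀, hp, n, A, B, ⟨hW, ?_⟩, ⟨hr, hpn'⟩, fun c => hcov.trans (hAB c)⟩
  -- (ii) from clause (X) at `(i, j, k) = (p', c, q)`
  intro c p' q hpq x hx y hy x' hx' y' hy' heq
  have h0 : (x' - x) + (y - y') = 0 := by
    rw [show (x' - x) + (y - y') = (y - x) - (y' - x') by abel, heq, sub_self]
  exact hpq (hX p' c q x' hx' x hx y hy y' hy' h0)

/-- **Forgetting the extra structure.**  A family of prime symmetric ladders (prime modulus, escape
clause for all `p ≠ q`, two-sided host control) is in particular a family of ordered cyclic ladders in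
the sense of the cyclic ladder conjecture (any modulus, clause for `p < q`, lower host bound only). -/
theorem cyclicLadder_of_primeSymmLadder
    (h : ∀ ε : ℝ, 0 < ε → ∀ m₀ : ℕ, ∃ m ≥ m₀, m.Prime ∧ ∃ r : ℕ, ∃ X Y : Fin r → Finset (ZMod m),
      ((∀ c : Fin r, ∀ x ∈ X c, ∀ x' ∈ X c, ∀ y ∈ Y c, ∀ y' ∈ Y c,
          (x - x') + (y - y') = 0 → x = x' ∧ y = y') ∧
        (∀ c p q : Fin r, p ≠ q → ∀ x ∈ X c, ∀ y ∈ Y c, ∀ x' ∈ X p, ∀ y' ∈ Y q,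
          y - x ≠ y' - x')) ∧
      ((m : ℝ) ^ (1 / 2 - ε) ≤ (r : ℝ) ∧ (m : ℝ) ≤ (r : ℝ) ^ (2 + ε)) ∧
      ∀ c : Fin r, (m : ℝ) ^ (1 - ε) ≤ (((X c).card * (Y c).card : ℕ) : ℝ)) :
    ∀ ε : ℝ, 0 < ε → ∀ m₀ : ℕ, ∃ m ≥ m₀, ∃ r : ℕ, ∃ X Y : Fin r → Finset (ZMod m),
      ((∀ c : Fin r, ∀ x ∈ X c, ∀ x' ∈ X c, ∀ y ∈ Y c, ∀ y' ∈ Y c,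
          (x - x') + (y - y') = 0 → x = x' ∧ y = y') ∧
        (∀ c p q : Fin r, p < q → ∀ x ∈ X c, ∀ y ∈ Y c, ∀ x' ∈ X p, ∀ y' ∈ Y q,
          y - x ≠ y' - x')) ∧
      (m : ℝ) ^ (1 / 2 - ε) ≤ (r : ℝ) ∧
      ∀ c : Fin r, (m : ℝ) ^ (1 - ε) ≤ (((X c).card * (Y c).card : ℕ) : ℝ) := by
  intro ε hε m₀
  obtain ⟨m, hm, -, r, X, Y, ⟨hW, hL⟩, ⟨hr, -⟩, hcov⟩ := h ε hε m₀
  exact ⟨m, hm, r, X, Y, ⟨hW, fun c p q hpq => hL c p q (ne_of_lt hpq)⟩, hr, hcov⟩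

/-- **The crux is a ladder** (registered stub `cyclicLadder_of_primeTwoFamilies` of crux item
stmt-MatrixMultiplication-14308, verbatim): `PrimeTwoFamilies` implies the cyclic ladder conjecture with
its two clauses inlined — for every `ε > 0` and `m₀` there are `m ≥ m₀`, `r` classes `(X c, Y c)` in
`ZMod m` with (i) every class direct, (ii) lower cross differences (`p < q`) avoiding all diagonal
differences, `m^{1/2-ε} ≤ r`, and co-volumes `m^{1-ε} ≤ |X c| |Y c|`.  Assembled from the prime
symmetric form `primeSymmLadder_of_primeTwoFamilies` by forgetting primality, the direction `q < p`
and the upper host bound (`cyclicLadder_of_primeSymmLadder`). -/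
theorem cyclicLadder_of_primeTwoFamilies (hT : FourierTwoFamiliesModP.PrimeTwoFamilies) :
    ∀ ε : ℝ, 0 < ε → ∀ m₀ : ℕ, ∃ m ≥ m₀, ∃ r : ℕ, ∃ X Y : Fin r → Finset (ZMod m),
      ((∀ c : Fin r, ∀ x ∈ X c, ∀ x' ∈ X c, ∀ y ∈ Y c, ∀ y' ∈ Y c,
          (x - x') + (y - y') = 0 → x = x' ∧ y = y') ∧
        (∀ c p q : Fin r, p < q → ∀ x ∈ X c, ∀ y ∈ Y c, ∀ x' ∈ X p, ∀ y' ∈ Y q,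
          y - x ≠ y' - x')) ∧
      (m : ℝ) ^ (1 / 2 - ε) ≤ (r : ℝ) ∧
      ∀ c : Fin r, (m : ℝ) ^ (1 - ε) ≤ (((X c).card * (Y c).card : ℕ) : ℝ) :=
  cyclicLadder_of_primeSymmLadder (primeSymmLadder_of_primeTwoFamilies hT)

/-- **`PrimeTwoFamilies ↔` prime symmetric cyclic ladders.**  CKSU Conj. 4.7 with prime cyclic hosts
holds iff for every `ε > 0` there are arbitrarily large PRIMES `m` and `r` classes `(X c, Y c)` in
`ZMod m` with (i) every class direct, (ii) cross differences of distinct classes (`p ≠ q`, both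
directions) avoiding all diagonal differences, `m^{1/2-ε} ≤ r`, `m ≤ r^{2+ε}`, and co-volumes
`m^{1-ε} ≤ |X c| |Y c|`.  (⇒) `primeSymmLadder_of_primeTwoFamilies`; (⇐) forget to ordered ladders
(`cyclicLadder_of_primeSymmLadder`) and apply the landed ladder equivalence
`LadderLift.primeTwoFamilies_iff_cyclicLadder` (constant-sum lift + carry-free transfer). -/
theorem primeTwoFamilies_iff_primeSymmLadder :
    FourierTwoFamiliesModP.PrimeTwoFamilies ↔
    (∀ ε : ℝ, 0 < ε → ∀ m₀ : ℕ, ∃ m ≥ m₀, m.Prime ∧ ∃ r : ℕ, ∃ X Y : Fin r → Finset (ZMod m),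
      ((∀ c : Fin r, ∀ x ∈ X c, ∀ x' ∈ X c, ∀ y ∈ Y c, ∀ y' ∈ Y c,
          (x - x') + (y - y') = 0 → x = x' ∧ y = y') ∧
        (∀ c p q : Fin r, p ≠ q → ∀ x ∈ X c, ∀ y ∈ Y c, ∀ x' ∈ X p, ∀ y' ∈ Y q,
          y - x ≠ y' - x')) ∧
      ((m : ℝ) ^ (1 / 2 - ε) ≤ (r : ℝ) ∧ (m : ℝ) ≤ (r : ℝ) ^ (2 + ε)) ∧
      ∀ c : Fin r, (m : ℝ) ^ (1 - ε) ≤ (((X c).card * (Y c).card : ℕ) : ℝ)) :=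
  ⟨primeSymmLadder_of_primeTwoFamilies,
    fun h => LadderLift.primeTwoFamilies_iff_cyclicLadder.2 (cyclicLadder_of_primeSymmLadder h)⟩

end Summit.MatrixMultiplication.MatrixMultiplication.Theorems.PrimeTwoFamilies.LadderSiegeK7
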